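import Summits.Ventures.LatticeQCDFlow.Scoring.U1TorusTopSusceptibilityContinuumLimit
import Mathlib.Analysis.Calculus.SmoothSeries
import HarnessLib

/-!
# The differentiated Jacobi identity and the second moment of the discrete Gaussian

HONEST FRAMING: exact (Metropolis-corrected) sampling algorithms for lattice gauge theory;
figures of merit are autocorrelation/cost numbers at stated couplings and volumes; no
continuum-physics claim.

Venture `LatticeQCDFlow` (cell pub-lqcd), sub-topic `Scoring`; FANOUT row 5 (`s0-sun-a`), GEN-15.
NEW WORK of the cell (placement rule).  `Scoring/U1TorusTopSusceptibilityContinuumLimit.lean` proved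
`⟨Q²⟩_{L_j,β_j} → (1/(4π²)) Σ_n (v − v²n²) e^{−vn²/2}/Σ_n e^{−vn²/2}`; the limit law of `Q` itself is the
discrete Gaussian `p_v(k) = e^{−2π²k²/v}/Σ_m e^{−2π²m²/v}`
(`Scoring/U1TorusTopologicalChargeContinuumLimit.lean`).  Differentiating Mathlib's Jacobi identity
`Σ_n e^{−πan²} = a^{−1/2} Σ_n e^{−πn²/a}` in `a` (termwise, `hasDerivAt_tsum_of_isPreconnected`)
identifies the two:

* `hasDerivAt_tsum_exp_neg_mul_sq` / `hasDerivAt_tsum_exp_neg_div_sq` — termwise derivatives of the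
  two theta series;
* **`tsum_sq_mul_exp_jacobi`** — `Σ_n (v − v²n²) e^{−vn²/2} / Σ_n e^{−vn²/2} = 4π² Σ_k k² e^{−2π²k²/v} / Σ_k e^{−2π²k²/v}`
  (`v > 0`);
* **`tendsto_integral_topCharge_sq_discreteGaussian`** — **`⟨Q²⟩_{L_j,β_j} → Σ_k k² p_v(k)`**, the
  second moment of the limiting sector law: the continuum topological susceptibility at fixed
  physical volume is that of the discrete Gaussian.

Elementary given the parents and Mathlib; nothing is cited.  No sampler values.
-/

noncomputable section

open Real Filter Topology Set MeasureTheory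
open scoped ENNReal
open Literature.Analysis.FunctionSpaces
open Literature.MathematicalPhysics.QuantumFieldTheory
open Literature.MathematicalPhysics.QuantumLattice (u1Rep)
open Summit.Ventures.LatticeQCDFlow.Theory2.Lattice (topCharge)

namespace Summit.Ventures.LatticeQCDFlow.Scoring

/-! ### 1. Summable Gaussian-polynomial majorants over `ℤ` -/

/-- `Σ_{n∈ℤ} n² e^{−c n²} < ∞` for `c > 0` (compare with `n² e^{−c|n|}`). -/
theorem summable_sq_mul_exp_neg_mul_sq {c : ℝ} (hc : 0 < c) :
    Summable fun n : ℤ => (n : ℝ) ^ 2 * Real.exp (-(c * (n : ℝ) ^ 2)) := by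
  refine Summable.of_nonneg_of_le (fun n => by positivity) (fun n => ?_) (summable_sq_mul_exp_neg_mul_natAbs hc)
  refine mul_le_mul_of_nonneg_left (Real.exp_le_exp.2 ?_) (sq_nonneg _)
  rw [Nat.cast_natAbs, Int.cast_abs]
  have : |(n : ℝ)| ≤ (n : ℝ) ^ 2 := by
    rw [← sq_abs]
    rcases eq_or_ne n 0 with rfl | hn
    · simp
    · have h1 : (1 : ℝ) ≤ |(n : ℝ)| := by rw [← Int.cast_abs]; exact_mod_cast Int.one_le_abs hn
      nlinarith
  nlinarith

/-! ### 2. Termwise derivatives of the two theta series -/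

/-- **`d/da Σ_n e^{−πan²} = Σ_n (−πn²) e^{−πan²}`** at every `a > 0`. -/
theorem hasDerivAt_tsum_exp_neg_mul_sq {a : ℝ} (ha : 0 < a) :
    HasDerivAt (fun y : ℝ => ∑' n : ℤ, Real.exp (-π * y * (n : ℝ) ^ 2))
      (∑' n : ℤ, -π * (n : ℝ) ^ 2 * Real.exp (-π * a * (n : ℝ) ^ 2)) a := by
  have hπ : 0 < π := Real.pi_pos
  have hc : 0 < π * (a / 2) := by positivity
  refine hasDerivAt_tsum_of_isPreconnected (t := Ioi (a / 2)) (y₀ := a)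
    (u := fun n : ℤ => π * ((n : ℝ) ^ 2 * Real.exp (-(π * (a / 2) * (n : ℝ) ^ 2))))
    (g := fun (n : ℤ) (y : ℝ) => Real.exp (-π * y * (n : ℝ) ^ 2))
    (g' := fun (n : ℤ) (y : ℝ) => -π * (n : ℝ) ^ 2 * Real.exp (-π * y * (n : ℝ) ^ 2))
    ((summable_sq_mul_exp_neg_mul_sq hc).mul_left π) isOpen_Ioi isPreconnected_Ioi ?_ ?_ (by simp [ha])
    ?_ (by simp [ha])
  · intro n y _
    have h := ((hasDerivAt_id y).const_mul (-π)).mul_const ((n : ℝ) ^ 2) |>.exp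
    refine h.congr_deriv ?_
    simp only [id]; ring
  · intro n y hy
    rw [Real.norm_eq_abs, abs_mul, abs_mul, abs_of_pos (Real.exp_pos _), abs_of_neg (by linarith : -π < 0),
      abs_of_nonneg (sq_nonneg _)]
    have hy' : a / 2 < y := hy
    have hnn := mul_nonneg (mul_nonneg hπ.le (sq_nonneg (n : ℝ))) (sub_nonneg.2 hy'.le)
    have : Real.exp (-π * y * (n : ℝ) ^ 2) ≤ Real.exp (-(π * (a / 2) * (n : ℝ) ^ 2)) :=
      Real.exp_le_exp.2 (by nlinarith [hnn])
    calc -(-π) * (n : ℝ) ^ 2 * Real.exp (-π * y * (n : ℝ) ^ 2)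
        = π * ((n : ℝ) ^ 2 * Real.exp (-π * y * (n : ℝ) ^ 2)) := by ring
      _ ≤ π * ((n : ℝ) ^ 2 * Real.exp (-(π * (a / 2) * (n : ℝ) ^ 2))) := by gcongr
  · have HC : 0 < π * a := by positivity
    have : Summable fun n : ℤ => Real.exp (-(π * a * (n : ℝ) ^ 2)) := (by
      refine Summable.of_nonneg_of_le (fun n => (Real.exp_pos _).le) (fun n => ?_)
        (summable_exp_neg_mul_natAbs HC)
      refine Real.exp_le_exp.2 ?_
      rw [Nat.cast_natAbs, Int.cast_abs]
      have : |(n : ℝ)| ≤ (n : ℝ) ^ 2 := by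
        rw [← sq_abs]
        rcases eq_or_ne n 0 with rfl | hn
        · simp
        · have h1 : (1 : ℝ) ≤ |(n : ℝ)| := by rw [← Int.cast_abs]; exact_mod_cast Int.one_le_abs hn
          nlinarith
      nlinarith)
    exact this.congr fun n => by ring_nf

/-- **`d/da Σ_n e^{−πn²/a} = Σ_n (πn²/a²) e^{−πn²/a}`** at every `a > 0`. -/
theorem hasDerivAt_tsum_exp_neg_div_sq {a : ℝ} (ha : 0 < a) :
    HasDerivAt (fun y : ℝ => ∑' n : ℤ, Real.exp (-π / y * (n : ℝ) ^ 2))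
      (∑' n : ℤ, π * (n : ℝ) ^ 2 / a ^ 2 * Real.exp (-π / a * (n : ℝ) ^ 2)) a := by
  have hπ : 0 < π := Real.pi_pos
  have hc : 0 < π / (2 * a) := by positivity
  refine hasDerivAt_tsum_of_isPreconnected (t := Ioo (a / 2) (2 * a)) (y₀ := a)
    (u := fun n : ℤ => 4 * π / a ^ 2 * ((n : ℝ) ^ 2 * Real.exp (-(π / (2 * a) * (n : ℝ) ^ 2))))
    (g := fun (n : ℤ) (y : ℝ) => Real.exp (-π / y * (n : ℝ) ^ 2))
    (g' := fun (n : ℤ) (y : ℝ) => π * (n : ℝ) ^ 2 / y ^ 2 * Real.exp (-π / y * (n : ℝ) ^ 2))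
    ((summable_sq_mul_exp_neg_mul_sq hc).mul_left _) isOpen_Ioo isPreconnected_Ioo ?_ ?_
    (by constructor <;> linarith) ?_ (by constructor <;> linarith)
  · intro n y hy
    have hy0 : y ≠ 0 := ne_of_gt (by linarith [hy.1])
    have h := (((hasDerivAt_inv hy0).const_mul (-π)).mul_const ((n : ℝ) ^ 2)).exp
    refine h.congr_deriv ?_
    field_simp
  · intro n y hy
    have hy1 : a / 2 < y := hy.1
    have hy2 : y < 2 * a := hy.2
    have hy0 : 0 < y := by linarith
    rw [Real.norm_eq_abs, abs_mul, abs_of_pos (Real.exp_pos _), abs_of_nonneg (by positivity)]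
    have h1 : π * (n : ℝ) ^ 2 / y ^ 2 ≤ 4 * π / a ^ 2 * (n : ℝ) ^ 2 := by
      rw [div_le_iff₀ (by positivity)]
      have : a ^ 2 ≤ 4 * y ^ 2 := by nlinarith
      have hn : 0 ≤ π * (n : ℝ) ^ 2 := by positivity
      calc π * (n : ℝ) ^ 2 = π * (n : ℝ) ^ 2 / a ^ 2 * a ^ 2 := by field_simp
        _ ≤ π * (n : ℝ) ^ 2 / a ^ 2 * (4 * y ^ 2) := by gcongr
        _ = 4 * π / a ^ 2 * (n : ℝ) ^ 2 * y ^ 2 := by ring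
    have h2 : Real.exp (-π / y * (n : ℝ) ^ 2) ≤ Real.exp (-(π / (2 * a) * (n : ℝ) ^ 2)) := by
      refine Real.exp_le_exp.2 ?_
      have : π / (2 * a) ≤ π / y := div_le_div_of_nonneg_left hπ.le hy0 hy2.le
      have e : -π / y * (n : ℝ) ^ 2 = -(π / y * (n : ℝ) ^ 2) := by ring
      rw [e]
      nlinarith [mul_le_mul_of_nonneg_right this (sq_nonneg (n : ℝ))]
    calc π * (n : ℝ) ^ 2 / y ^ 2 * Real.exp (-π / y * (n : ℝ) ^ 2)
        ≤ 4 * π / a ^ 2 * (n : ℝ) ^ 2 * Real.exp (-(π / (2 * a) * (n : ℝ) ^ 2)) :=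
          mul_le_mul h1 h2 (Real.exp_pos _).le (by positivity)
      _ = _ := by ring
  · have HC : 0 < π / a := by positivity
    have : Summable fun n : ℤ => Real.exp (-(π / a * (n : ℝ) ^ 2)) := (by
      refine Summable.of_nonneg_of_le (fun n => (Real.exp_pos _).le) (fun n => ?_)
        (summable_exp_neg_mul_natAbs HC)
      refine Real.exp_le_exp.2 ?_
      rw [Nat.cast_natAbs, Int.cast_abs]
      have : |(n : ℝ)| ≤ (n : ℝ) ^ 2 := by
        rw [← sq_abs]
        rcases eq_or_ne n 0 with rfl | hn
        · simp
        · have h1 : (1 : ℝ) ≤ |(n : ℝ)| := by rw [← Int.cast_abs]; exact_mod_cast Int.one_le_abs hn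
          nlinarith
      nlinarith)
    exact this.congr fun n => by ring_nf

/-! ### 3. The differentiated Jacobi identity -/

/-- **Differentiated Jacobi identity**: for `a > 0`,
`Σ_n (−πn²) e^{−πan²} = −½ a^{−3/2} Σ_n e^{−πn²/a} + a^{−1/2} Σ_n (πn²/a²) e^{−πn²/a}`. -/
theorem tsum_deriv_jacobi {a : ℝ} (ha : 0 < a) :
    ∑' n : ℤ, -π * (n : ℝ) ^ 2 * Real.exp (-π * a * (n : ℝ) ^ 2) =
      -(1 / 2) * a ^ (-(3 / 2 : ℝ)) * ∑' n : ℤ, Real.exp (-π / a * (n : ℝ) ^ 2) +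
        a ^ (-(1 / 2 : ℝ)) * ∑' n : ℤ, π * (n : ℝ) ^ 2 / a ^ 2 * Real.exp (-π / a * (n : ℝ) ^ 2) := by
  have hF := hasDerivAt_tsum_exp_neg_mul_sq ha
  have hH := hasDerivAt_tsum_exp_neg_div_sq ha
  -- `G y = y^{−1/2} H y` and its derivative
  have hpow : HasDerivAt (fun y : ℝ => y ^ (-(1 / 2 : ℝ))) (-(1 / 2) * a ^ (-(1 / 2 : ℝ) - 1)) a :=
    Real.hasDerivAt_rpow_const (Or.inl ha.ne')
  have hG := hpow.mul hH
  -- `F = G` near `a`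
  have hFG : (fun y : ℝ => ∑' n : ℤ, Real.exp (-π * y * (n : ℝ) ^ 2)) =ᶠ[𝓝 a]
      fun y => y ^ (-(1 / 2 : ℝ)) * ∑' n : ℤ, Real.exp (-π / y * (n : ℝ) ^ 2) := by
    filter_upwards [Ioi_mem_nhds ha] with y hy
    rw [Real.tsum_exp_neg_mul_int_sq hy, Real.rpow_neg hy.le, one_div]
  have hF' := (hFG.hasDerivAt_iff).2 hG
  have heq := hF.unique hF'
  rw [heq, show -(1 / 2 : ℝ) - 1 = -(3 / 2 : ℝ) by norm_num]

/-- **The second moment of the discrete Gaussian**: for `v > 0`,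
`(1/(4π²)) Σ_n (v − v²n²) e^{−vn²/2} / Σ_n e^{−vn²/2} = Σ_k k² e^{−2π²k²/v} / Σ_k e^{−2π²k²/v}`. -/
theorem tsum_sq_mul_exp_jacobi {v : ℝ} (hv : 0 < v) :
    1 / (4 * π ^ 2) * (∑' n : ℤ, (v - v ^ 2 * (n : ℝ) ^ 2) * Real.exp (-(v * (n : ℝ) ^ 2 / 2))) /
        ∑' n : ℤ, Real.exp (-(v * (n : ℝ) ^ 2 / 2)) =
      (∑' k : ℤ, (k : ℝ) ^ 2 * Real.exp (-(2 * π ^ 2 * (k : ℝ) ^ 2 / v))) /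
        ∑' k : ℤ, Real.exp (-(2 * π ^ 2 * (k : ℝ) ^ 2 / v)) := by
  have hπ : 0 < π := Real.pi_pos
  set a := v / (2 * π) with hadef
  have ha : 0 < a := by positivity
  have hJ := Real.tsum_exp_neg_mul_int_sq ha
  have hD := tsum_deriv_jacobi ha
  -- rewrite the exponents
  have e1 : ∀ n : ℤ, Real.exp (-π * a * (n : ℝ) ^ 2) = Real.exp (-(v * (n : ℝ) ^ 2 / 2)) := fun n => by
    congr 1; rw [hadef]; field_simp
  have e2 : ∀ n : ℤ, Real.exp (-π / a * (n : ℝ) ^ 2) = Real.exp (-(2 * π ^ 2 * (n : ℝ) ^ 2 / v)) := fun n => by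
    congr 1; rw [hadef]; field_simp
  simp only [e1, e2] at hJ hD
  set θ₁ := ∑' n : ℤ, Real.exp (-(v * (n : ℝ) ^ 2 / 2)) with hθ₁
  set θ₂ := ∑' n : ℤ, Real.exp (-(2 * π ^ 2 * (n : ℝ) ^ 2 / v)) with hθ₂
  set S₁ := ∑' n : ℤ, (n : ℝ) ^ 2 * Real.exp (-(v * (n : ℝ) ^ 2 / 2)) with hS₁
  set S₂ := ∑' n : ℤ, (n : ℝ) ^ 2 * Real.exp (-(2 * π ^ 2 * (n : ℝ) ^ 2 / v)) with hS₂
  -- summability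
  have hsθ₁ : Summable fun n : ℤ => Real.exp (-(v * (n : ℝ) ^ 2 / 2)) := by
    have HC : 0 < v / 2 := by positivity
    have : Summable fun n : ℤ => Real.exp (-(v / 2 * (n : ℝ) ^ 2)) := (by
      refine Summable.of_nonneg_of_le (fun n => (Real.exp_pos _).le) (fun n => ?_)
        (summable_exp_neg_mul_natAbs HC)
      refine Real.exp_le_exp.2 ?_
      rw [Nat.cast_natAbs, Int.cast_abs]
      have : |(n : ℝ)| ≤ (n : ℝ) ^ 2 := by
        rw [← sq_abs]
        rcases eq_or_ne n 0 with rfl | hn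
        · simp
        · have h1 : (1 : ℝ) ≤ |(n : ℝ)| := by rw [← Int.cast_abs]; exact_mod_cast Int.one_le_abs hn
          nlinarith
      nlinarith)
    exact this.congr fun n => by ring_nf
  have hsS₁ : Summable fun n : ℤ => (n : ℝ) ^ 2 * Real.exp (-(v * (n : ℝ) ^ 2 / 2)) :=
    (summable_sq_mul_exp_neg_mul_sq (by positivity : 0 < v / 2)).congr fun n => by ring_nf
  have hsS₂ : Summable fun n : ℤ => (n : ℝ) ^ 2 * Real.exp (-(2 * π ^ 2 * (n : ℝ) ^ 2 / v)) :=
    (summable_sq_mul_exp_neg_mul_sq (by positivity : 0 < 2 * π ^ 2 / v)).congr fun n => by ring_nf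
  have hθ₂pos : 0 < θ₂ := by
    have HC : 0 < 2 * π ^ 2 / v := by positivity
    have hs' : Summable fun n : ℤ => Real.exp (-(2 * π ^ 2 / v * (n : ℝ) ^ 2)) := (by
      refine Summable.of_nonneg_of_le (fun n => (Real.exp_pos _).le) (fun n => ?_)
        (summable_exp_neg_mul_natAbs HC)
      refine Real.exp_le_exp.2 ?_
      rw [Nat.cast_natAbs, Int.cast_abs]
      have : |(n : ℝ)| ≤ (n : ℝ) ^ 2 := by
        rw [← sq_abs]
        rcases eq_or_ne n 0 with rfl | hn
        · simp
        · have h1 : (1 : ℝ) ≤ |(n : ℝ)| := by rw [← Int.cast_abs]; exact_mod_cast Int.one_le_abs hn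
          nlinarith
      nlinarith)
    have hs : Summable fun n : ℤ => Real.exp (-(2 * π ^ 2 * (n : ℝ) ^ 2 / v)) :=
      hs'.congr fun n => by ring_nf
    exact hs.tsum_pos (fun n => (Real.exp_pos _).le) 0 (Real.exp_pos _)
  -- the derivative identity in terms of `S₁, θ₂, S₂`
  have hL : ∑' n : ℤ, -π * (n : ℝ) ^ 2 * Real.exp (-(v * (n : ℝ) ^ 2 / 2)) = -π * S₁ := by
    rw [hS₁, ← tsum_mul_left]; exact tsum_congr fun n => by ring
  have hR : ∑' n : ℤ, π * (n : ℝ) ^ 2 / a ^ 2 * Real.exp (-(2 * π ^ 2 * (n : ℝ) ^ 2 / v)) = π / a ^ 2 * S₂ := by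
    rw [hS₂, ← tsum_mul_left]; exact tsum_congr fun n => by ring
  rw [hL, hR] at hD
  -- numerator: `Σ (v − v²n²) e = v θ₁ − v² S₁`
  have hN : ∑' n : ℤ, (v - v ^ 2 * (n : ℝ) ^ 2) * Real.exp (-(v * (n : ℝ) ^ 2 / 2)) = v * θ₁ - v ^ 2 * S₁ := by
    have := (hsθ₁.mul_left v).tsum_sub (hsS₁.mul_left (v ^ 2))
    rw [tsum_mul_left, tsum_mul_left] at this
    rw [← this]
    exact tsum_congr fun n => by ring
  rw [hN]
  -- `θ₁ = a^{−1/2} θ₂` (Jacobi) and the rpow algebra `a^{−3/2} = a^{−1/2}/a`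
  have hθ₁J : θ₁ = 1 / a ^ (1 / 2 : ℝ) * θ₂ := hJ
  have hr1 : a ^ (-(1 / 2 : ℝ)) = 1 / a ^ (1 / 2 : ℝ) := by rw [Real.rpow_neg ha.le, inv_eq_one_div]
  have hr3 : a ^ (-(3 / 2 : ℝ)) = 1 / a ^ (1 / 2 : ℝ) / a := by
    rw [show (-(3 / 2 : ℝ)) = -(1 / 2 : ℝ) + (-1) by norm_num, Real.rpow_add ha, Real.rpow_neg_one, hr1]
    ring
  have hsq : 0 < a ^ (1 / 2 : ℝ) := Real.rpow_pos_of_pos ha _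
  rw [hr1, hr3] at hD
  set r := 1 / a ^ (1 / 2 : ℝ) with hr
  have hr0 : 0 < r := by positivity
  -- from `hD`: `−π S₁ = −½ (r/a) θ₂ + r (π/a²) S₂`, i.e. `S₁ = r θ₂/(2πa) − r S₂/a²`
  have hS₁eq : S₁ = r * θ₂ / (2 * π * a) - r * S₂ / a ^ 2 := by
    field_simp
    field_simp at hD
    linarith
  rw [hS₁eq, hθ₁J]
  have hrne := hr0.ne'
  have hθ₂ne := hθ₂pos.ne'
  rw [hadef]
  field_simp
  ring

/-! ### 4. The topological susceptibility converges to the second moment of the discrete Gaussian -/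

variable {Ls : ℕ → ℕ} [hNZ : ∀ j, NeZero (Ls j)]

/-- **`⟨Q²⟩_{L_j,β_j} → Σ_k k² e^{−2π²k²/v} / Σ_k e^{−2π²k²/v}`** — the continuum topological
susceptibility at fixed physical volume is the second moment of the limiting sector law. -/
theorem tendsto_integral_topCharge_sq_discreteGaussian {β : ℕ → ℝ} {v : ℝ} (hv0 : 0 < v)
    (hL : ∀ j, 2 ≤ Ls j) (hβ : Tendsto β atTop atTop)
    (hv : Tendsto (fun j => ((Ls j ^ 2 : ℕ) : ℝ) / β j) atTop (𝓝 v)) :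
    Tendsto (fun j => ∫ U, (topCharge U) ^ 2 ∂(wilsonMeasure (d := 2) (L := Ls j) u1Rep (β j))) atTop
      (𝓝 ((∑' k : ℤ, (k : ℝ) ^ 2 * Real.exp (-(2 * π ^ 2 * (k : ℝ) ^ 2 / v))) /
        ∑' k : ℤ, Real.exp (-(2 * π ^ 2 * (k : ℝ) ^ 2 / v)))) := by
  rw [← tsum_sq_mul_exp_jacobi hv0]
  exact tendsto_integral_topCharge_sq hv0 hL hβ hv

end Summit.Ventures.LatticeQCDFlow.Scoring
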